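import Summits.CriticalPhenomena.Ising3DConformalLimit.Theses.LocalisationClock

/-!
# Line `site-bayes` for crux `LocalisationGHS` — item stmt-CriticalPhenomena-15882 (strategist line, ALT to `birth`)

Route `LocalisationClock` (route-CriticalPhenomena-LocalisationClock), crux rank 2, concluded BY NAME:
`Summit.CriticalPhenomena.Ising3DConformalLimit.Theses.LocalisationClock.LocalisationGHS`
(planted Gaussian channel on a block `e` of a finite zero-field ferromagnet `c ≥ 0`, SNR `s ≥ 0`; posterior block
mean `m(y)`, `A_a(y) = Cov_y(σ_a, M_e)`, clock rate `r = Σ_{a∈e} A_a²`, planted law `P`; claim `P[r·m²] ≤ P[r]·P[m²]`;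
signature fixed by the route, never restated here).

## The line: ONE-SITE BAYES FACTORISATION ON THE NISHIMORI LINE (DSS-style one-spin `tanh` algebra, per observed site)

Write the crux sitewise, `P[r m²] − P[r]P[m²] = Σ_{a∈e} T_a`, `T_a := P[A_a² m²] − P[A_a²]P[m²]` (the multi-SNR
gradient `∂κ₄(m)/∂s_a = 6 T_a` of the fourth cumulant of the Bayes estimator — NOTES/idea `kappa4-clock-gradient`).
Fix `a ∈ e`, put `y⁰ := y[a ↦ 0]` (site `a` unobserved), `τ := ⟨σ_a⟩_{y⁰}` (`= tanh h`, the environment's field on `a`),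
`M^± := ⟨M_e 𝟙{σ_a = ±1}⟩_{y⁰} / ((1 ± τ)/2)`, `S̄ := (M⁺+M⁻)/2` (block polarisation given the environment),
`D := (M⁺−M⁻)/2 ≥ 0` (sensitivity of the block to `σ_a`). Then EXACTLY (Bayes at one site; checked to 1e-15):

    m(y) = S̄ + D·tanh(y_a + h),        A_a(y) = D·sech²(y_a + h),

and, under the planted law GIVEN `y_{-a}`, `u := y_a + h` has the one-spin planted law `π_{h,s} ∝ cosh(u) e^{-(u-h)²/2s}`
(prior log-odds `2h` from the environment — Nishimori: `E_π tanh u = tanh h`; spelled below WITHOUT `artanh` through the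
Möbius addition `tanh(h + w) = (τ + tanh w)/(1 + τ tanh w)` and the two-point mixture over the planted sign of `σ_a`).
Law of total covariance over `y_{-a}` gives the IDENTITY (stub 1)

    T_a = I_a + X_a + O_a,   I_a = P[D⁴ f₁(τ)],   X_a = P[2 S̄ D³ f₂(τ)],
    O_a = Cov_P( D² g₁(τ) ,  S̄² + 2 S̄ D τ + D² g₂(τ) ),

with the explicit 1-D kernels of `π_{h,s}`: `g₁ = E sech⁴u`, `g₂ = E tanh²u`, `f₁ = Cov(sech⁴u, tanh²u)`,
`f₂ = Cov(sech⁴u, tanh u)`. Signs: `f₁ ≤ 0` for EVERY law of `u` (Chebyshev: `sech⁴ = (1 − tanh²)²` is decreasing in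
`tanh²`) ⇒ `I_a ≤ 0` (stub 2); `f₂` is odd in `h` and `≤ 0` for `h ≥ 0` (tilted even/odd Chebyshev lemma: `π_{h,s}` is the
exponential tilt `e^{uh/s}` of an even law — first lemma of stub 3); `g₁` is even and decreasing in `|h|`, `g₂` increasing.
So `X_a ≤ 0` (stub 3) says the block polarisation `S̄` of the environment and the field `h` it exerts on `a` are
SIGN-COHERENT on average with the weight `D³|f₂(h)|` — the FKG face of the crux (aligned sub-blocks are likelier than
opposed ones in a ferromagnet; for OPPOSED deterministic fields the inequality is false: two independent spins in fields
`(+g, −g)` give `Cov_P(r, m²) > 0`, strategist kit j024254 PART A) — and `O_a ≤ 0` (stub 4) says that, as functionals of the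
environment data `y_{-a}` alone, the smoothed site rate `D² g₁(h)` (small when the environment is stiff or polarises `a`)
and the smoothed squared block polarisation `S̄² + 2S̄Dτ + D²g₂` are negatively correlated — the crux's own shape ONE
OBSERVED SITE DOWN (site `a` hidden), i.e. the `s_a = 0⁺` face of the multi-SNR clock. Composition: sum over `a ∈ e`.

Numerical certificate (strategist kit j024254 quick; j024420 / j024423 full sweep: 78 (system, mask) pairs — pair/chain/tri
exact, 2×2×2 cube, 3×3 torus, K₆/K₈, hidden-hub star, weakly joined clusters, dimer chain, 12 random weighted graphs, with
partial observation — × 10 SNRs 0.05…8; MC 1.5–2·10⁵ planted samples with exact 2ⁿ posterior enumeration): the crux defect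
T and every sitewise T_a are < 0 in every row (≥ 10 standard errors); identity residual `chk` ≤ quadrature/MC error;
I_a < 0 and X_a < 0 in every row; O_a < 0 in every row at s ≤ 5 (e.g. pair J=0.5, s=1: rel I/X/O = −0.164/−0.086/−0.039
per site, T = −0.577 = birth's N+S); at s = 8 only, 17 MC systems read rel O_a ∈ [+0.0001, +0.003] — traced to the
48-node Gauss–Hermite 1-D kernels under-resolving the width-1/√s peak (v2 runs with tabulated kernels: kit j024705-7,
attached to the item; the large-s face of O_a is a zero-field GKS II statement, card §Stubs). Full tables and the recorded
three-stub fallback (`Xpc a + Opc a ≤ 0`): `Lines/site-bayes.md`.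

Why not SNR regimes / why not birth's split: birth conditions on the SIGNAL σ* (N: Gaussian-noise covariance given σ*,
S: zero-field Gibbs covariance); this line conditions on the ENVIRONMENT DATA `y_{-a}` one site at a time, which makes the
`y_a`-integration EXPLICIT (1-D kernels) and leaves two FKG-type statements about `(S̄, D, h)`; the two cuts are transverse
(neither piece of one is a piece of the other). The DSS induction on revealed spins (in-tree
`pair_signedFieldDomination`) does NOT transfer: revealing a spin creates signed fields and the signed-field extension
of the crux is false (PART A above) — hence conditioning on `y_{-a}` (site unobserved), never on `σ_a` (site revealed).

Disproof / negatives: no `Disproof.lean` for this crux yet (cdisprove seat not started, 2026-08-17); `ledger negatives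
--problem CriticalPhenomena`: none in Ising3DConformalLimit, none about planted/posterior covariances — no stub is an
instance of a refuted statement. Strategist: planner-cstrat-stmt-CriticalPhenomena-15882-b1-0 (2026-08-17).
-/

namespace Summit.CriticalPhenomena.Ising3DConformalLimit.Cruxes.LocalisationGHS.SiteBayes

open MeasureTheory ProbabilityTheory
open Literature.Probability.LatticeModels
open Summit.CriticalPhenomena.Ising3DConformalLimit.Theses.LocalisationClock (LocalisationGHS)

set_option linter.unusedVariables false

/-! ## Registered stubs (four statements; `LocalisationGHS_of` takes exactly these)

Common let-telescope: the crux's `tilt, blk, m, Af, r, P` VERBATIM, then the site functionals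
`y0 y a = y[a ↦ 0]`, `τf y a = ⟨σ_a⟩_{y0}`, `Mp/Mm y a = ⟨M_e 𝟙{σ_a = ±1}⟩_{y0}/((1 ± τf)/2)`, `Sb = (Mp+Mm)/2`,
`Dd = (Mp−Mm)/2`, the one-spin planted kernels `kg1 = E sech⁴`, `kg2 = E tanh²`, `kk1 = E sech⁴·tanh`,
`kk2 = E sech⁴·tanh²` of `π_{h,s}` as functions of `τ = tanh h` (Möbius spelling, `γ₁ = N(0,1)`), and the pieces
`Ipc a = P[Dd⁴ (kk2 − kg1·kg2)]`, `Xpc a = P[2 Sb Dd³ (kk1 − kg1·τf)]`, `Opc a = P[F G] − P[F] P[G]` with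
`F = Dd² kg1(τf)`, `G = Sb² + 2 Sb Dd τf + Dd² kg2(τf)`. -/

/-- **Stub 1 — ONE-SITE BAYES IDENTITY (size L; Gaussian/Bayes calculus, no inequality).** For every finite
ferromagnet, block `e`, SNR `s ≥ 0`: `P[r m²] − P[r]P[m²] = Σ_{a ∈ e} (Ipc a + Xpc a + Opc a)`. Ingredients: linearity of
`P` over `r = Σ_{a∈e} A_a²` (bounded continuous integrands); Bayes at site `a`: `m = Sb + Dd·tanh(y_a + h)`,
`A_a = Dd·sech²(y_a + h)` with `tanh h = τf` (exact algebra); disintegration of the planted law along `y_a` given `y_{-a}`: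
`σ*_a | y_{-a}` has mean `τf` (Nishimori) and `y_a = sσ*_a + √s z_a` — so `tanh(y_a + h) = mob τf (tanh(±s + √s z))`;
then the law of total covariance. [arXiv:2109.00709 (planted channel / Nishimori); arXiv:2107.09243 §2 (one-spin tanh
algebra); Lines/site-bayes.md §Identity] -/
theorem stub_siteBayes :
    ∀ (n : ℕ) (c : Fin n → Fin n → ℝ) (e : Fin n → Bool) (s : ℝ), (∀ a b, 0 ≤ c a b) → 0 ≤ s →
      let tilt : (Fin n → ℝ) → (SpinConfig (Fin n) → ℝ) → ℝ := fun y g =>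
        PairIsing.gibbsAvg c (fun σ => g σ * Real.exp (∑ a, y a * spinAt a σ)) /
          PairIsing.gibbsAvg c (fun σ => Real.exp (∑ a, y a * spinAt a σ))
      let blk : SpinConfig (Fin n) → ℝ := fun σ => ∑ a, if e a then spinAt a σ else 0
      let m : (Fin n → ℝ) → ℝ := fun y => tilt y blk
      let Af : (Fin n → ℝ) → Fin n → ℝ := fun y a =>
        tilt y (fun σ => spinAt a σ * blk σ) - tilt y (spinAt a) * m y
      let r : (Fin n → ℝ) → ℝ := fun y => ∑ a, if e a then Af y a ^ 2 else 0
      let P : ((Fin n → ℝ) → ℝ) → ℝ := fun Φ =>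
        PairIsing.gibbsAvg c (fun σ => ∫ z, Φ (fun a => if e a then s * spinAt a σ + Real.sqrt s * z a else 0)
          ∂(Measure.pi fun _ : Fin n => gaussianReal 0 1))
      let y0 : (Fin n → ℝ) → Fin n → (Fin n → ℝ) := fun y a => Function.update y a 0
      let τf : (Fin n → ℝ) → Fin n → ℝ := fun y a => tilt (y0 y a) (spinAt a)
      let Mp : (Fin n → ℝ) → Fin n → ℝ := fun y a =>
        tilt (y0 y a) (fun σ => if σ a = 1 then blk σ else 0) / ((1 + τf y a) / 2)
      let Mm : (Fin n → ℝ) → Fin n → ℝ := fun y a =>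
        tilt (y0 y a) (fun σ => if σ a = 1 then 0 else blk σ) / ((1 - τf y a) / 2)
      let Sb : (Fin n → ℝ) → Fin n → ℝ := fun y a => (Mp y a + Mm y a) / 2
      let Dd : (Fin n → ℝ) → Fin n → ℝ := fun y a => (Mp y a - Mm y a) / 2
      let γ₁ : Measure ℝ := gaussianReal 0 1
      let mob : ℝ → ℝ → ℝ := fun τ t => (t + τ) / (1 + τ * t)
      let Eπ : ℝ → (ℝ → ℝ) → ℝ := fun τ φ =>
        (1 + τ) / 2 * ∫ z, φ (mob τ (Real.tanh (s + Real.sqrt s * z))) ∂γ₁ +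
          (1 - τ) / 2 * ∫ z, φ (mob τ (Real.tanh (-s + Real.sqrt s * z))) ∂γ₁
      let kg1 : ℝ → ℝ := fun τ => Eπ τ (fun T => (1 - T ^ 2) ^ 2)
      let kg2 : ℝ → ℝ := fun τ => Eπ τ (fun T => T ^ 2)
      let kk1 : ℝ → ℝ := fun τ => Eπ τ (fun T => (1 - T ^ 2) ^ 2 * T)
      let kk2 : ℝ → ℝ := fun τ => Eπ τ (fun T => (1 - T ^ 2) ^ 2 * T ^ 2)
      let F : (Fin n → ℝ) → Fin n → ℝ := fun y a => Dd y a ^ 2 * kg1 (τf y a)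
      let G : (Fin n → ℝ) → Fin n → ℝ := fun y a =>
        Sb y a ^ 2 + 2 * Sb y a * Dd y a * τf y a + Dd y a ^ 2 * kg2 (τf y a)
      let Ipc : Fin n → ℝ := fun a => P (fun y => Dd y a ^ 4 * (kk2 (τf y a) - kg1 (τf y a) * kg2 (τf y a)))
      let Xpc : Fin n → ℝ := fun a => P (fun y => 2 * Sb y a * Dd y a ^ 3 * (kk1 (τf y a) - kg1 (τf y a) * τf y a))
      let Opc : Fin n → ℝ := fun a => P (fun y => F y a * G y a) - P (fun y => F y a) * P (fun y => G y a)
      P (fun y => r y * m y ^ 2) - P r * P (fun y => m y ^ 2) = ∑ a, if e a then Ipc a + Xpc a + Opc a else 0 := by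
  sorry

/-- **Stub 2 — INNER CHEBYSHEV (size M).** `Ipc a ≤ 0` for every site `a`: the one-spin kernel
`f₁(τ) = kk2 − kg1·kg2 = Cov_π(sech⁴u, tanh²u)` is `≤ 0` for EVERY probability law of `u` (Chebyshev's covariance
inequality: `(1 − T²)²` is non-increasing and `T²` non-decreasing in `T² ∈ [0,1]`; here the law is the two-point
mixture of Gaussian pushforwards, weights `(1 ± τf)/2 ∈ [0,1]` since `|τf| ≤ 1`), `Dd⁴ ≥ 0`, and `P` is a positive
functional (`integral_nonpos` + `gibbsAvg_nonneg`). No ferromagnetism needed. [Chebyshev sum inequality;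
Literature.Probability.LatticeModels.PairIsing.gibbsAvg_nonneg] -/
theorem stub_innerChebyshev :
    ∀ (n : ℕ) (c : Fin n → Fin n → ℝ) (e : Fin n → Bool) (s : ℝ), (∀ a b, 0 ≤ c a b) → 0 ≤ s → ∀ a : Fin n,
      let tilt : (Fin n → ℝ) → (SpinConfig (Fin n) → ℝ) → ℝ := fun y g =>
        PairIsing.gibbsAvg c (fun σ => g σ * Real.exp (∑ a, y a * spinAt a σ)) /
          PairIsing.gibbsAvg c (fun σ => Real.exp (∑ a, y a * spinAt a σ))
      let blk : SpinConfig (Fin n) → ℝ := fun σ => ∑ a, if e a then spinAt a σ else 0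
      let m : (Fin n → ℝ) → ℝ := fun y => tilt y blk
      let Af : (Fin n → ℝ) → Fin n → ℝ := fun y a =>
        tilt y (fun σ => spinAt a σ * blk σ) - tilt y (spinAt a) * m y
      let r : (Fin n → ℝ) → ℝ := fun y => ∑ a, if e a then Af y a ^ 2 else 0
      let P : ((Fin n → ℝ) → ℝ) → ℝ := fun Φ =>
        PairIsing.gibbsAvg c (fun σ => ∫ z, Φ (fun a => if e a then s * spinAt a σ + Real.sqrt s * z a else 0)
          ∂(Measure.pi fun _ : Fin n => gaussianReal 0 1))
      let y0 : (Fin n → ℝ) → Fin n → (Fin n → ℝ) := fun y a => Function.update y a 0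
      let τf : (Fin n → ℝ) → Fin n → ℝ := fun y a => tilt (y0 y a) (spinAt a)
      let Mp : (Fin n → ℝ) → Fin n → ℝ := fun y a =>
        tilt (y0 y a) (fun σ => if σ a = 1 then blk σ else 0) / ((1 + τf y a) / 2)
      let Mm : (Fin n → ℝ) → Fin n → ℝ := fun y a =>
        tilt (y0 y a) (fun σ => if σ a = 1 then 0 else blk σ) / ((1 - τf y a) / 2)
      let Sb : (Fin n → ℝ) → Fin n → ℝ := fun y a => (Mp y a + Mm y a) / 2
      let Dd : (Fin n → ℝ) → Fin n → ℝ := fun y a => (Mp y a - Mm y a) / 2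
      let γ₁ : Measure ℝ := gaussianReal 0 1
      let mob : ℝ → ℝ → ℝ := fun τ t => (t + τ) / (1 + τ * t)
      let Eπ : ℝ → (ℝ → ℝ) → ℝ := fun τ φ =>
        (1 + τ) / 2 * ∫ z, φ (mob τ (Real.tanh (s + Real.sqrt s * z))) ∂γ₁ +
          (1 - τ) / 2 * ∫ z, φ (mob τ (Real.tanh (-s + Real.sqrt s * z))) ∂γ₁
      let kg1 : ℝ → ℝ := fun τ => Eπ τ (fun T => (1 - T ^ 2) ^ 2)
      let kg2 : ℝ → ℝ := fun τ => Eπ τ (fun T => T ^ 2)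
      let kk1 : ℝ → ℝ := fun τ => Eπ τ (fun T => (1 - T ^ 2) ^ 2 * T)
      let kk2 : ℝ → ℝ := fun τ => Eπ τ (fun T => (1 - T ^ 2) ^ 2 * T ^ 2)
      let F : (Fin n → ℝ) → Fin n → ℝ := fun y a => Dd y a ^ 2 * kg1 (τf y a)
      let G : (Fin n → ℝ) → Fin n → ℝ := fun y a =>
        Sb y a ^ 2 + 2 * Sb y a * Dd y a * τf y a + Dd y a ^ 2 * kg2 (τf y a)
      let Ipc : Fin n → ℝ := fun a => P (fun y => Dd y a ^ 4 * (kk2 (τf y a) - kg1 (τf y a) * kg2 (τf y a)))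
      let Xpc : Fin n → ℝ := fun a => P (fun y => 2 * Sb y a * Dd y a ^ 3 * (kk1 (τf y a) - kg1 (τf y a) * τf y a))
      let Opc : Fin n → ℝ := fun a => P (fun y => F y a * G y a) - P (fun y => F y a) * P (fun y => G y a)
      Ipc a ≤ 0 := by
  sorry

/-- **Stub 3 — CROSS SIGN-COHERENCE (size L; the FKG face of the crux).** For `a ∈ e`: `Xpc a ≤ 0`, i.e.
`P[ S̄ · D³ · f₂(h) ] ≤ 0` where `f₂(τ) = kk1 − kg1·τ = Cov_{π_{h,s}}(sech⁴u, tanh u)` is ODD in `h` and `≤ 0` for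
`h ≥ 0` — FIRST LEMMA (tilted even/odd Chebyshev, elementary, paper-proved and checked numerically): for an even law
`p₀`, `g` even and non-increasing in `|u|`, `t` odd non-decreasing, `θ ≥ 0`: `Cov_{p₀ e^{θu}}(g, t) ≤ 0`; here
`π_{h,s} ∝ cosh(u)e^{-u²/2s} · e^{uh/s}`. Hence `Xpc a = −2·P[ |S̄| D³ |f₂(h)| · sign(S̄)·sign(h) ] ≤ 0` iff the block
polarisation `S̄(y_{-a})` of the environment and the field `h(y_{-a})` it exerts on site `a` — both odd, increasing
(FKG) functionals of `y_{-a}` under the even, positively associated planted law — agree in sign on (weighted) average.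
False for frozen OPPOSED fields (two free spins in fields `(+g,−g)`: `Cov_P(r,m²) > 0`, kit j024254 A), so the planted
average and the ferromagnetic association are both load-bearing. Numerics: `Xpc < 0` in every row; opposed-sign weight
0 in pair/chain/tri/K₆ (pointwise coherence there). [Literature.Probability.LatticeModels.field_fkg (FKG with arbitrary
fields); arXiv:2107.09243; FKG/Holley for the joint Ising–Gaussian law] -/
theorem stub_crossCoherence :
    ∀ (n : ℕ) (c : Fin n → Fin n → ℝ) (e : Fin n → Bool) (s : ℝ), (∀ a b, 0 ≤ c a b) → 0 ≤ s → ∀ a : Fin n,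
      e a = true →
      let tilt : (Fin n → ℝ) → (SpinConfig (Fin n) → ℝ) → ℝ := fun y g =>
        PairIsing.gibbsAvg c (fun σ => g σ * Real.exp (∑ a, y a * spinAt a σ)) /
          PairIsing.gibbsAvg c (fun σ => Real.exp (∑ a, y a * spinAt a σ))
      let blk : SpinConfig (Fin n) → ℝ := fun σ => ∑ a, if e a then spinAt a σ else 0
      let m : (Fin n → ℝ) → ℝ := fun y => tilt y blk
      let Af : (Fin n → ℝ) → Fin n → ℝ := fun y a =>
        tilt y (fun σ => spinAt a σ * blk σ) - tilt y (spinAt a) * m y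
      let r : (Fin n → ℝ) → ℝ := fun y => ∑ a, if e a then Af y a ^ 2 else 0
      let P : ((Fin n → ℝ) → ℝ) → ℝ := fun Φ =>
        PairIsing.gibbsAvg c (fun σ => ∫ z, Φ (fun a => if e a then s * spinAt a σ + Real.sqrt s * z a else 0)
          ∂(Measure.pi fun _ : Fin n => gaussianReal 0 1))
      let y0 : (Fin n → ℝ) → Fin n → (Fin n → ℝ) := fun y a => Function.update y a 0
      let τf : (Fin n → ℝ) → Fin n → ℝ := fun y a => tilt (y0 y a) (spinAt a)
      let Mp : (Fin n → ℝ) → Fin n → ℝ := fun y a =>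
        tilt (y0 y a) (fun σ => if σ a = 1 then blk σ else 0) / ((1 + τf y a) / 2)
      let Mm : (Fin n → ℝ) → Fin n → ℝ := fun y a =>
        tilt (y0 y a) (fun σ => if σ a = 1 then 0 else blk σ) / ((1 - τf y a) / 2)
      let Sb : (Fin n → ℝ) → Fin n → ℝ := fun y a => (Mp y a + Mm y a) / 2
      let Dd : (Fin n → ℝ) → Fin n → ℝ := fun y a => (Mp y a - Mm y a) / 2
      let γ₁ : Measure ℝ := gaussianReal 0 1
      let mob : ℝ → ℝ → ℝ := fun τ t => (t + τ) / (1 + τ * t)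
      let Eπ : ℝ → (ℝ → ℝ) → ℝ := fun τ φ =>
        (1 + τ) / 2 * ∫ z, φ (mob τ (Real.tanh (s + Real.sqrt s * z))) ∂γ₁ +
          (1 - τ) / 2 * ∫ z, φ (mob τ (Real.tanh (-s + Real.sqrt s * z))) ∂γ₁
      let kg1 : ℝ → ℝ := fun τ => Eπ τ (fun T => (1 - T ^ 2) ^ 2)
      let kg2 : ℝ → ℝ := fun τ => Eπ τ (fun T => T ^ 2)
      let kk1 : ℝ → ℝ := fun τ => Eπ τ (fun T => (1 - T ^ 2) ^ 2 * T)
      let kk2 : ℝ → ℝ := fun τ => Eπ τ (fun T => (1 - T ^ 2) ^ 2 * T ^ 2)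
      let F : (Fin n → ℝ) → Fin n → ℝ := fun y a => Dd y a ^ 2 * kg1 (τf y a)
      let G : (Fin n → ℝ) → Fin n → ℝ := fun y a =>
        Sb y a ^ 2 + 2 * Sb y a * Dd y a * τf y a + Dd y a ^ 2 * kg2 (τf y a)
      let Ipc : Fin n → ℝ := fun a => P (fun y => Dd y a ^ 4 * (kk2 (τf y a) - kg1 (τf y a) * kg2 (τf y a)))
      let Xpc : Fin n → ℝ := fun a => P (fun y => 2 * Sb y a * Dd y a ^ 3 * (kk1 (τf y a) - kg1 (τf y a) * τf y a))
      let Opc : Fin n → ℝ := fun a => P (fun y => F y a * G y a) - P (fun y => F y a) * P (fun y => G y a)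
      Xpc a ≤ 0 := by
  sorry

/-- **Stub 4 — OUTER COHERENCE, one observed site down (size L).** For `a ∈ e`: `Opc a ≤ 0`, i.e. under the planted
law of the ENVIRONMENT data `y_{-a}` (site `a` in the block but unobserved — the `s_a = 0⁺` face of the multi-SNR clock)
the smoothed site rate `F = D²·g₁(h)` (`g₁ = E_π sech⁴` even, decreasing in `|h|`: small when the environment is stiff,
`D` small, or polarises `a`, `|h|` large) and the smoothed squared block polarisation
`G = S̄² + 2S̄D·tanh h + D²g₂(h) = E[m² | y_{-a}]` are negatively correlated: `P[F G] ≤ P[F] P[G]`. Same SHAPE as the crux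
(rate vs. squared polarisation, both even functionals of planted data) for a system with one observed site fewer and
explicit one-spin smoothing — the natural seat of an induction on `|e|` / of birth-type (signal/noise) conditioning
applied to `y_{-a}`. Checks: c = 0 ⇒ `D ≡ 1`, `h ≡ 0`, `F` constant ⇒ `Opc = 0`; |e| = 1 ⇒ `S̄ = 0`, `D = 1`, `τ`
from hidden spins only … ; numerics: `Opc < 0` in every row (rel −0.01 … −0.09), and the un-smoothed face
`O0 = Cov(D² sech⁴h, (S̄ + Dτ)²) < 0` too. [FKG for the joint Ising–Gaussian law; GHS
(Literature.Probability.LatticeModels.ghs_gksSum) for the `|h|`-monotonicity heuristics; Lines/site-bayes.md] -/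
theorem stub_outerCoherence :
    ∀ (n : ℕ) (c : Fin n → Fin n → ℝ) (e : Fin n → Bool) (s : ℝ), (∀ a b, 0 ≤ c a b) → 0 ≤ s → ∀ a : Fin n,
      e a = true →
      let tilt : (Fin n → ℝ) → (SpinConfig (Fin n) → ℝ) → ℝ := fun y g =>
        PairIsing.gibbsAvg c (fun σ => g σ * Real.exp (∑ a, y a * spinAt a σ)) /
          PairIsing.gibbsAvg c (fun σ => Real.exp (∑ a, y a * spinAt a σ))
      let blk : SpinConfig (Fin n) → ℝ := fun σ => ∑ a, if e a then spinAt a σ else 0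
      let m : (Fin n → ℝ) → ℝ := fun y => tilt y blk
      let Af : (Fin n → ℝ) → Fin n → ℝ := fun y a =>
        tilt y (fun σ => spinAt a σ * blk σ) - tilt y (spinAt a) * m y
      let r : (Fin n → ℝ) → ℝ := fun y => ∑ a, if e a then Af y a ^ 2 else 0
      let P : ((Fin n → ℝ) → ℝ) → ℝ := fun Φ =>
        PairIsing.gibbsAvg c (fun σ => ∫ z, Φ (fun a => if e a then s * spinAt a σ + Real.sqrt s * z a else 0)
          ∂(Measure.pi fun _ : Fin n => gaussianReal 0 1))
      let y0 : (Fin n → ℝ) → Fin n → (Fin n → ℝ) := fun y a => Function.update y a 0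
      let τf : (Fin n → ℝ) → Fin n → ℝ := fun y a => tilt (y0 y a) (spinAt a)
      let Mp : (Fin n → ℝ) → Fin n → ℝ := fun y a =>
        tilt (y0 y a) (fun σ => if σ a = 1 then blk σ else 0) / ((1 + τf y a) / 2)
      let Mm : (Fin n → ℝ) → Fin n → ℝ := fun y a =>
        tilt (y0 y a) (fun σ => if σ a = 1 then 0 else blk σ) / ((1 - τf y a) / 2)
      let Sb : (Fin n → ℝ) → Fin n → ℝ := fun y a => (Mp y a + Mm y a) / 2
      let Dd : (Fin n → ℝ) → Fin n → ℝ := fun y a => (Mp y a - Mm y a) / 2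
      let γ₁ : Measure ℝ := gaussianReal 0 1
      let mob : ℝ → ℝ → ℝ := fun τ t => (t + τ) / (1 + τ * t)
      let Eπ : ℝ → (ℝ → ℝ) → ℝ := fun τ φ =>
        (1 + τ) / 2 * ∫ z, φ (mob τ (Real.tanh (s + Real.sqrt s * z))) ∂γ₁ +
          (1 - τ) / 2 * ∫ z, φ (mob τ (Real.tanh (-s + Real.sqrt s * z))) ∂γ₁
      let kg1 : ℝ → ℝ := fun τ => Eπ τ (fun T => (1 - T ^ 2) ^ 2)
      let kg2 : ℝ → ℝ := fun τ => Eπ τ (fun T => T ^ 2)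
      let kk1 : ℝ → ℝ := fun τ => Eπ τ (fun T => (1 - T ^ 2) ^ 2 * T)
      let kk2 : ℝ → ℝ := fun τ => Eπ τ (fun T => (1 - T ^ 2) ^ 2 * T ^ 2)
      let F : (Fin n → ℝ) → Fin n → ℝ := fun y a => Dd y a ^ 2 * kg1 (τf y a)
      let G : (Fin n → ℝ) → Fin n → ℝ := fun y a =>
        Sb y a ^ 2 + 2 * Sb y a * Dd y a * τf y a + Dd y a ^ 2 * kg2 (τf y a)
      let Ipc : Fin n → ℝ := fun a => P (fun y => Dd y a ^ 4 * (kk2 (τf y a) - kg1 (τf y a) * kg2 (τf y a)))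
      let Xpc : Fin n → ℝ := fun a => P (fun y => 2 * Sb y a * Dd y a ^ 3 * (kk1 (τf y a) - kg1 (τf y a) * τf y a))
      let Opc : Fin n → ℝ := fun a => P (fun y => F y a * G y a) - P (fun y => F y a) * P (fun y => G y a)
      Opc a ≤ 0 := by
  sorry

/-! ## Composition (sorry-free): the four stub STATEMENTS imply the crux, by name -/

/-- **COMPOSITION.** identity → inner → cross → outer → `LocalisationGHS` (the LocalisationClock decl of item
stmt-CriticalPhenomena-15882): by the identity the defect `P[r m²] − P[r]P[m²]` is `Σ_{a∈e}(Ipc a + Xpc a + Opc a)`,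
a sum of three nonpositive pieces per observed site. -/
theorem LocalisationGHS_of :
    (∀ (n : ℕ) (c : Fin n → Fin n → ℝ) (e : Fin n → Bool) (s : ℝ), (∀ a b, 0 ≤ c a b) → 0 ≤ s →
      let tilt : (Fin n → ℝ) → (SpinConfig (Fin n) → ℝ) → ℝ := fun y g =>
        PairIsing.gibbsAvg c (fun σ => g σ * Real.exp (∑ a, y a * spinAt a σ)) /
          PairIsing.gibbsAvg c (fun σ => Real.exp (∑ a, y a * spinAt a σ))
      let blk : SpinConfig (Fin n) → ℝ := fun σ => ∑ a, if e a then spinAt a σ else 0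
      let m : (Fin n → ℝ) → ℝ := fun y => tilt y blk
      let Af : (Fin n → ℝ) → Fin n → ℝ := fun y a =>
        tilt y (fun σ => spinAt a σ * blk σ) - tilt y (spinAt a) * m y
      let r : (Fin n → ℝ) → ℝ := fun y => ∑ a, if e a then Af y a ^ 2 else 0
      let P : ((Fin n → ℝ) → ℝ) → ℝ := fun Φ =>
        PairIsing.gibbsAvg c (fun σ => ∫ z, Φ (fun a => if e a then s * spinAt a σ + Real.sqrt s * z a else 0)
          ∂(Measure.pi fun _ : Fin n => gaussianReal 0 1))
      let y0 : (Fin n → ℝ) → Fin n → (Fin n → ℝ) := fun y a => Function.update y a 0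
      let τf : (Fin n → ℝ) → Fin n → ℝ := fun y a => tilt (y0 y a) (spinAt a)
      let Mp : (Fin n → ℝ) → Fin n → ℝ := fun y a =>
        tilt (y0 y a) (fun σ => if σ a = 1 then blk σ else 0) / ((1 + τf y a) / 2)
      let Mm : (Fin n → ℝ) → Fin n → ℝ := fun y a =>
        tilt (y0 y a) (fun σ => if σ a = 1 then 0 else blk σ) / ((1 - τf y a) / 2)
      let Sb : (Fin n → ℝ) → Fin n → ℝ := fun y a => (Mp y a + Mm y a) / 2
      let Dd : (Fin n → ℝ) → Fin n → ℝ := fun y a => (Mp y a - Mm y a) / 2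
      let γ₁ : Measure ℝ := gaussianReal 0 1
      let mob : ℝ → ℝ → ℝ := fun τ t => (t + τ) / (1 + τ * t)
      let Eπ : ℝ → (ℝ → ℝ) → ℝ := fun τ φ =>
        (1 + τ) / 2 * ∫ z, φ (mob τ (Real.tanh (s + Real.sqrt s * z))) ∂γ₁ +
          (1 - τ) / 2 * ∫ z, φ (mob τ (Real.tanh (-s + Real.sqrt s * z))) ∂γ₁
      let kg1 : ℝ → ℝ := fun τ => Eπ τ (fun T => (1 - T ^ 2) ^ 2)
      let kg2 : ℝ → ℝ := fun τ => Eπ τ (fun T => T ^ 2)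
      let kk1 : ℝ → ℝ := fun τ => Eπ τ (fun T => (1 - T ^ 2) ^ 2 * T)
      let kk2 : ℝ → ℝ := fun τ => Eπ τ (fun T => (1 - T ^ 2) ^ 2 * T ^ 2)
      let F : (Fin n → ℝ) → Fin n → ℝ := fun y a => Dd y a ^ 2 * kg1 (τf y a)
      let G : (Fin n → ℝ) → Fin n → ℝ := fun y a =>
        Sb y a ^ 2 + 2 * Sb y a * Dd y a * τf y a + Dd y a ^ 2 * kg2 (τf y a)
      let Ipc : Fin n → ℝ := fun a => P (fun y => Dd y a ^ 4 * (kk2 (τf y a) - kg1 (τf y a) * kg2 (τf y a)))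
      let Xpc : Fin n → ℝ := fun a => P (fun y => 2 * Sb y a * Dd y a ^ 3 * (kk1 (τf y a) - kg1 (τf y a) * τf y a))
      let Opc : Fin n → ℝ := fun a => P (fun y => F y a * G y a) - P (fun y => F y a) * P (fun y => G y a)
      P (fun y => r y * m y ^ 2) - P r * P (fun y => m y ^ 2) = ∑ a, if e a then Ipc a + Xpc a + Opc a else 0) →
    (∀ (n : ℕ) (c : Fin n → Fin n → ℝ) (e : Fin n → Bool) (s : ℝ), (∀ a b, 0 ≤ c a b) → 0 ≤ s → ∀ a : Fin n,
      let tilt : (Fin n → ℝ) → (SpinConfig (Fin n) → ℝ) → ℝ := fun y g =>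
        PairIsing.gibbsAvg c (fun σ => g σ * Real.exp (∑ a, y a * spinAt a σ)) /
          PairIsing.gibbsAvg c (fun σ => Real.exp (∑ a, y a * spinAt a σ))
      let blk : SpinConfig (Fin n) → ℝ := fun σ => ∑ a, if e a then spinAt a σ else 0
      let m : (Fin n → ℝ) → ℝ := fun y => tilt y blk
      let Af : (Fin n → ℝ) → Fin n → ℝ := fun y a =>
        tilt y (fun σ => spinAt a σ * blk σ) - tilt y (spinAt a) * m y
      let r : (Fin n → ℝ) → ℝ := fun y => ∑ a, if e a then Af y a ^ 2 else 0
      let P : ((Fin n → ℝ) → ℝ) → ℝ := fun Φ =>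
        PairIsing.gibbsAvg c (fun σ => ∫ z, Φ (fun a => if e a then s * spinAt a σ + Real.sqrt s * z a else 0)
          ∂(Measure.pi fun _ : Fin n => gaussianReal 0 1))
      let y0 : (Fin n → ℝ) → Fin n → (Fin n → ℝ) := fun y a => Function.update y a 0
      let τf : (Fin n → ℝ) → Fin n → ℝ := fun y a => tilt (y0 y a) (spinAt a)
      let Mp : (Fin n → ℝ) → Fin n → ℝ := fun y a =>
        tilt (y0 y a) (fun σ => if σ a = 1 then blk σ else 0) / ((1 + τf y a) / 2)
      let Mm : (Fin n → ℝ) → Fin n → ℝ := fun y a =>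
        tilt (y0 y a) (fun σ => if σ a = 1 then 0 else blk σ) / ((1 - τf y a) / 2)
      let Sb : (Fin n → ℝ) → Fin n → ℝ := fun y a => (Mp y a + Mm y a) / 2
      let Dd : (Fin n → ℝ) → Fin n → ℝ := fun y a => (Mp y a - Mm y a) / 2
      let γ₁ : Measure ℝ := gaussianReal 0 1
      let mob : ℝ → ℝ → ℝ := fun τ t => (t + τ) / (1 + τ * t)
      let Eπ : ℝ → (ℝ → ℝ) → ℝ := fun τ φ =>
        (1 + τ) / 2 * ∫ z, φ (mob τ (Real.tanh (s + Real.sqrt s * z))) ∂γ₁ +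
          (1 - τ) / 2 * ∫ z, φ (mob τ (Real.tanh (-s + Real.sqrt s * z))) ∂γ₁
      let kg1 : ℝ → ℝ := fun τ => Eπ τ (fun T => (1 - T ^ 2) ^ 2)
      let kg2 : ℝ → ℝ := fun τ => Eπ τ (fun T => T ^ 2)
      let kk1 : ℝ → ℝ := fun τ => Eπ τ (fun T => (1 - T ^ 2) ^ 2 * T)
      let kk2 : ℝ → ℝ := fun τ => Eπ τ (fun T => (1 - T ^ 2) ^ 2 * T ^ 2)
      let F : (Fin n → ℝ) → Fin n → ℝ := fun y a => Dd y a ^ 2 * kg1 (τf y a)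
      let G : (Fin n → ℝ) → Fin n → ℝ := fun y a =>
        Sb y a ^ 2 + 2 * Sb y a * Dd y a * τf y a + Dd y a ^ 2 * kg2 (τf y a)
      let Ipc : Fin n → ℝ := fun a => P (fun y => Dd y a ^ 4 * (kk2 (τf y a) - kg1 (τf y a) * kg2 (τf y a)))
      let Xpc : Fin n → ℝ := fun a => P (fun y => 2 * Sb y a * Dd y a ^ 3 * (kk1 (τf y a) - kg1 (τf y a) * τf y a))
      let Opc : Fin n → ℝ := fun a => P (fun y => F y a * G y a) - P (fun y => F y a) * P (fun y => G y a)
      Ipc a ≤ 0) →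
    (∀ (n : ℕ) (c : Fin n → Fin n → ℝ) (e : Fin n → Bool) (s : ℝ), (∀ a b, 0 ≤ c a b) → 0 ≤ s → ∀ a : Fin n,
      e a = true →
      let tilt : (Fin n → ℝ) → (SpinConfig (Fin n) → ℝ) → ℝ := fun y g =>
        PairIsing.gibbsAvg c (fun σ => g σ * Real.exp (∑ a, y a * spinAt a σ)) /
          PairIsing.gibbsAvg c (fun σ => Real.exp (∑ a, y a * spinAt a σ))
      let blk : SpinConfig (Fin n) → ℝ := fun σ => ∑ a, if e a then spinAt a σ else 0
      let m : (Fin n → ℝ) → ℝ := fun y => tilt y blk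
      let Af : (Fin n → ℝ) → Fin n → ℝ := fun y a =>
        tilt y (fun σ => spinAt a σ * blk σ) - tilt y (spinAt a) * m y
      let r : (Fin n → ℝ) → ℝ := fun y => ∑ a, if e a then Af y a ^ 2 else 0
      let P : ((Fin n → ℝ) → ℝ) → ℝ := fun Φ =>
        PairIsing.gibbsAvg c (fun σ => ∫ z, Φ (fun a => if e a then s * spinAt a σ + Real.sqrt s * z a else 0)
          ∂(Measure.pi fun _ : Fin n => gaussianReal 0 1))
      let y0 : (Fin n → ℝ) → Fin n → (Fin n → ℝ) := fun y a => Function.update y a 0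
      let τf : (Fin n → ℝ) → Fin n → ℝ := fun y a => tilt (y0 y a) (spinAt a)
      let Mp : (Fin n → ℝ) → Fin n → ℝ := fun y a =>
        tilt (y0 y a) (fun σ => if σ a = 1 then blk σ else 0) / ((1 + τf y a) / 2)
      let Mm : (Fin n → ℝ) → Fin n → ℝ := fun y a =>
        tilt (y0 y a) (fun σ => if σ a = 1 then 0 else blk σ) / ((1 - τf y a) / 2)
      let Sb : (Fin n → ℝ) → Fin n → ℝ := fun y a => (Mp y a + Mm y a) / 2
      let Dd : (Fin n → ℝ) → Fin n → ℝ := fun y a => (Mp y a - Mm y a) / 2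
      let γ₁ : Measure ℝ := gaussianReal 0 1
      let mob : ℝ → ℝ → ℝ := fun τ t => (t + τ) / (1 + τ * t)
      let Eπ : ℝ → (ℝ → ℝ) → ℝ := fun τ φ =>
        (1 + τ) / 2 * ∫ z, φ (mob τ (Real.tanh (s + Real.sqrt s * z))) ∂γ₁ +
          (1 - τ) / 2 * ∫ z, φ (mob τ (Real.tanh (-s + Real.sqrt s * z))) ∂γ₁
      let kg1 : ℝ → ℝ := fun τ => Eπ τ (fun T => (1 - T ^ 2) ^ 2)
      let kg2 : ℝ → ℝ := fun τ => Eπ τ (fun T => T ^ 2)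
      let kk1 : ℝ → ℝ := fun τ => Eπ τ (fun T => (1 - T ^ 2) ^ 2 * T)
      let kk2 : ℝ → ℝ := fun τ => Eπ τ (fun T => (1 - T ^ 2) ^ 2 * T ^ 2)
      let F : (Fin n → ℝ) → Fin n → ℝ := fun y a => Dd y a ^ 2 * kg1 (τf y a)
      let G : (Fin n → ℝ) → Fin n → ℝ := fun y a =>
        Sb y a ^ 2 + 2 * Sb y a * Dd y a * τf y a + Dd y a ^ 2 * kg2 (τf y a)
      let Ipc : Fin n → ℝ := fun a => P (fun y => Dd y a ^ 4 * (kk2 (τf y a) - kg1 (τf y a) * kg2 (τf y a)))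
      let Xpc : Fin n → ℝ := fun a => P (fun y => 2 * Sb y a * Dd y a ^ 3 * (kk1 (τf y a) - kg1 (τf y a) * τf y a))
      let Opc : Fin n → ℝ := fun a => P (fun y => F y a * G y a) - P (fun y => F y a) * P (fun y => G y a)
      Xpc a ≤ 0) →
    (∀ (n : ℕ) (c : Fin n → Fin n → ℝ) (e : Fin n → Bool) (s : ℝ), (∀ a b, 0 ≤ c a b) → 0 ≤ s → ∀ a : Fin n,
      e a = true →
      let tilt : (Fin n → ℝ) → (SpinConfig (Fin n) → ℝ) → ℝ := fun y g =>
        PairIsing.gibbsAvg c (fun σ => g σ * Real.exp (∑ a, y a * spinAt a σ)) /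
          PairIsing.gibbsAvg c (fun σ => Real.exp (∑ a, y a * spinAt a σ))
      let blk : SpinConfig (Fin n) → ℝ := fun σ => ∑ a, if e a then spinAt a σ else 0
      let m : (Fin n → ℝ) → ℝ := fun y => tilt y blk
      let Af : (Fin n → ℝ) → Fin n → ℝ := fun y a =>
        tilt y (fun σ => spinAt a σ * blk σ) - tilt y (spinAt a) * m y
      let r : (Fin n → ℝ) → ℝ := fun y => ∑ a, if e a then Af y a ^ 2 else 0
      let P : ((Fin n → ℝ) → ℝ) → ℝ := fun Φ =>
        PairIsing.gibbsAvg c (fun σ => ∫ z, Φ (fun a => if e a then s * spinAt a σ + Real.sqrt s * z a else 0)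
          ∂(Measure.pi fun _ : Fin n => gaussianReal 0 1))
      let y0 : (Fin n → ℝ) → Fin n → (Fin n → ℝ) := fun y a => Function.update y a 0
      let τf : (Fin n → ℝ) → Fin n → ℝ := fun y a => tilt (y0 y a) (spinAt a)
      let Mp : (Fin n → ℝ) → Fin n → ℝ := fun y a =>
        tilt (y0 y a) (fun σ => if σ a = 1 then blk σ else 0) / ((1 + τf y a) / 2)
      let Mm : (Fin n → ℝ) → Fin n → ℝ := fun y a =>
        tilt (y0 y a) (fun σ => if σ a = 1 then 0 else blk σ) / ((1 - τf y a) / 2)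
      let Sb : (Fin n → ℝ) → Fin n → ℝ := fun y a => (Mp y a + Mm y a) / 2
      let Dd : (Fin n → ℝ) → Fin n → ℝ := fun y a => (Mp y a - Mm y a) / 2
      let γ₁ : Measure ℝ := gaussianReal 0 1
      let mob : ℝ → ℝ → ℝ := fun τ t => (t + τ) / (1 + τ * t)
      let Eπ : ℝ → (ℝ → ℝ) → ℝ := fun τ φ =>
        (1 + τ) / 2 * ∫ z, φ (mob τ (Real.tanh (s + Real.sqrt s * z))) ∂γ₁ +
          (1 - τ) / 2 * ∫ z, φ (mob τ (Real.tanh (-s + Real.sqrt s * z))) ∂γ₁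
      let kg1 : ℝ → ℝ := fun τ => Eπ τ (fun T => (1 - T ^ 2) ^ 2)
      let kg2 : ℝ → ℝ := fun τ => Eπ τ (fun T => T ^ 2)
      let kk1 : ℝ → ℝ := fun τ => Eπ τ (fun T => (1 - T ^ 2) ^ 2 * T)
      let kk2 : ℝ → ℝ := fun τ => Eπ τ (fun T => (1 - T ^ 2) ^ 2 * T ^ 2)
      let F : (Fin n → ℝ) → Fin n → ℝ := fun y a => Dd y a ^ 2 * kg1 (τf y a)
      let G : (Fin n → ℝ) → Fin n → ℝ := fun y a =>
        Sb y a ^ 2 + 2 * Sb y a * Dd y a * τf y a + Dd y a ^ 2 * kg2 (τf y a)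
      let Ipc : Fin n → ℝ := fun a => P (fun y => Dd y a ^ 4 * (kk2 (τf y a) - kg1 (τf y a) * kg2 (τf y a)))
      let Xpc : Fin n → ℝ := fun a => P (fun y => 2 * Sb y a * Dd y a ^ 3 * (kk1 (τf y a) - kg1 (τf y a) * τf y a))
      let Opc : Fin n → ℝ := fun a => P (fun y => F y a * G y a) - P (fun y => F y a) * P (fun y => G y a)
      Opc a ≤ 0) →
    LocalisationGHS := by
  intro hId hI hX hO n c e s hc hs
  have h1 := hId n c e s hc hs
  have h2 := hI n c e s hc hs
  have h3 := hX n c e s hc hs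
  have h4 := hO n c e s hc hs
  dsimp only at h1 h2 h3 h4 ⊢
  rw [← sub_nonpos, h1]
  refine Finset.sum_nonpos fun a _ => ?_
  split_ifs with ha
  · have h2a := h2 a
    have h3a := h3 a ha
    have h4a := h4 a ha
    linarith
  · exact le_rfl

/-- The crux from the four registered stubs (shows the stubs have exactly the hypothesis types of
`LocalisationGHS_of`; its only `sorry`s are the stubs'). -/
theorem LocalisationGHS_of_stubs : LocalisationGHS :=
  LocalisationGHS_of stub_siteBayes stub_innerChebyshev stub_crossCoherence stub_outerCoherence

end Summit.CriticalPhenomena.Ising3DConformalLimit.Cruxes.LocalisationGHS.SiteBayes
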